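import Summits.HubbardSuperconductivity.HubbardSuperconductivity.Theorems.AnisotropyChordFourTorusKernelCertY

/-!
# Route `AnisotropyChord` / crux `ChordXY` at `M = 4`: kernel decisions for certificate matrices Y1, Y2
# (prover seat `hubbard-h0-rotor-p1` g18)
-/

set_option linter.style.longLine false
set_option linter.dupNamespace false
set_option autoImplicit false

namespace Summit.HubbardSuperconductivity.HubbardSuperconductivity.Theorems.AnisotropyChord.FourTorus

/-- certificate `Y1`: residual diagonally dominant, rows `< 29`. [folklore] -/
theorem certDomY_1_lo : certDomY 1 0 = true := by decide +kernel
/-- certificate `Y1`: residual diagonally dominant, rows `≥ 29`. [folklore] -/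
theorem certDomY_1_hi : certDomY 1 1 = true := by decide +kernel
/-- certificate `Y1`: the matrix is symmetric. [folklore] -/
theorem certSymY_1 : certSymY 1 = true := by decide +kernel
/-- certificate `Y2`: residual diagonally dominant, rows `< 29`. [folklore] -/
theorem certDomY_2_lo : certDomY 2 0 = true := by decide +kernel
/-- certificate `Y2`: residual diagonally dominant, rows `≥ 29`. [folklore] -/
theorem certDomY_2_hi : certDomY 2 1 = true := by decide +kernel
/-- certificate `Y2`: the matrix is symmetric. [folklore] -/
theorem certSymY_2 : certSymY 2 = true := by decide +kernel

end Summit.HubbardSuperconductivity.HubbardSuperconductivity.Theorems.AnisotropyChord.FourTorus
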